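import Summits.Ventures.CertifiedQuantumChemistry.Rows.HubbardHalfFilledHeisenbergSpinLimit
import Summits.Ventures.CertifiedQuantumChemistry.Rows.HeisenbergRingL12GroundEnergyBracket
import HarnessLib

/-!
# Ventures/CertifiedQuantumChemistry — Rows/HubbardRingL12StrongCouplingLimit.lean: the strong-coupling constant of
# the half-filled Hubbard 12-ring, `lim U·E₀(12;U) = 4E₀(Σ_{i∈ℤ/12} 𝐒_i·𝐒_{i+1}) − 12 ∈ [−33.54956366978096, −33.54956366978076]`
# (T-K0-12, bracket form)

HONEST FRAMING (verbatim): certified bounds for a stated model Hamiltonian in a stated basis; not a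
claim about the real molecule beyond that model.

Seat ref/typer (`pub-qchem-typer`, gen 21). THEOREMS ONLY (no `def`, no claim node, no row, no certificate),
zero compute, standard axioms; scores nothing, moves no `CERTIFIED.md` byte. The `L = 12` member of the family
T-K0-4 / 6 / 8 / 10 (`Rows/HubbardRingStrongCouplingLimit.lean`, `Rows/HubbardRingL6StrongCouplingLimit.lean`,
`Rows/HubbardRingL8L10StrongCouplingLimit.lean`): by `Rows/HubbardHalfFilledHeisenbergSpinLimit.lean` ((S):
`U · Model.energy (hubbardRingTV L 1 U) n n → 4·E₀(heisenbergHamiltonian 1 (ringGraph L) 1) − L`, every `L = 2n ≥ 3`)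
the limit EXISTS and equals the explicit real number `c₁₂ := 4·E₀(heisenbergHamiltonian 1 (ringGraph 12) 1) − 12`
(`= −4 h(12)`, HOME/STRUCTURE.md §2.2.3); by the kernel Collatz–Wielandt bracket of
`Rows/HeisenbergRingL12GroundEnergyBracket.lean` (`E₀ ∈ [−5.38739091744524, −5.38739091744519]`),

  `c₁₂ ∈ [−33.54956366978096, −33.54956366978076]`   (width `2e-13`; `c₁₂ = −33.5495636697808…`).

Unlike `L ≤ 10` no exact algebraic form of `c₁₂` is given (none is needed; the minimal polynomial of `−c₁₂ = μ₁₂`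
has degree `> 6`).

References: Takahashi (1999) / Essler et al. (2005) App. 2.A through (S); Marshall (1955), Lieb–Mattis (1962) Thm 2,
Tasaki (2020) §2.4 Thm 2.3, Horn–Johnson (2013) Cor. 8.1.29 through the bracket file; Bonner–Fisher (1964)
(`E₀(12)/12 = −0.448949`). Typer `pub-qchem-typer` (gen 21), 0 core-h.
-/

noncomputable section

namespace Summit.Ventures.CertifiedQuantumChemistry

open Filter Topology
open Literature.MathematicalPhysics.QuantumLattice Literature.MathematicalPhysics.QuantumChemistry
open Summit.Ventures.CertifiedQuantumChemistry.Hamiltonians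

/-- **T-K0-12 (limit).** `U · E_(6,6)(hubbardRingTV 12 1 U) → 4·E₀(Σ_{i∈ℤ/12} 𝐒_i·𝐒_{i+1}) − 12` as `U → ∞` along `ℚ`
((S) at `L = 12`, `n = 6`). -/
theorem tendsto_mul_energy_hubbardRingTV_twelve :
    Tendsto (fun U : ℚ => (U : ℝ) * (hubbardRingTV 12 1 U).energy 6 6) atTop
      (𝓝 (4 * (heisenbergHamiltonian 1 (ringGraph 12) 1).groundEnergy - 12)) := by
  exact_mod_cast tendsto_mul_energy_hubbardRingTV_halfFilled_groundEnergy_sub (L := 12) (n := 6) rfl (by norm_num)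

/-- **T-K0-12 (bracket of the constant).** `4·E₀(Σ_{i∈ℤ/12} 𝐒_i·𝐒_{i+1}) − 12 ∈ [−33.54956366978096, −33.54956366978076]`
(`= −4 h(12)`, `h(12) ∈ [8.38739091744519, 8.38739091744524]`). -/
theorem strongCouplingConstant_twelve_mem_Icc :
    4 * (heisenbergHamiltonian 1 (ringGraph 12) 1).groundEnergy - 12 ∈
      Set.Icc (-(3354956366978096 / 10 ^ 14 : ℝ)) (-(3354956366978076 / 10 ^ 14)) := by
  obtain ⟨hlo, hhi⟩ := HeisenbergRing12.groundEnergy_mem_Icc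
  constructor <;> linarith

/-- **T-K0-12, packaged.** There is `c ∈ [−33.54956366978096, −33.54956366978076]` with
`U · E_(6,6)(hubbardRingTV 12 1 U) → c` (`U → ∞` along `ℚ`); i.e. `lim U·E₀(12;U) = −4 h(12) = −33.5495636697808…`. -/
theorem tendsto_mul_energy_hubbardRingTV_twelve_mem_Icc :
    ∃ c : ℝ, c ∈ Set.Icc (-(3354956366978096 / 10 ^ 14 : ℝ)) (-(3354956366978076 / 10 ^ 14)) ∧
      Tendsto (fun U : ℚ => (U : ℝ) * (hubbardRingTV 12 1 U).energy 6 6) atTop (𝓝 c) :=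
  ⟨_, strongCouplingConstant_twelve_mem_Icc, tendsto_mul_energy_hubbardRingTV_twelve⟩

/-- The same limit in the `S_z`-sector (`minEnergyOn (szSector 12 0)`) spelling of T-K0-4. -/
theorem tendsto_mul_minEnergyOn_szSector_hubbardRingTV_twelve :
    Tendsto (fun U : ℚ => (U : ℝ) * ((hubbardRingTV 12 1 U).hamiltonian.minEnergyOn (szSector 12 0))) atTop
      (𝓝 (4 * (heisenbergHamiltonian 1 (ringGraph 12) 1).groundEnergy - 12)) := by
  refine tendsto_mul_energy_hubbardRingTV_twelve.congr fun U => ?_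
  rw [Model.energy, sectorGroundEnergy_def, sub_self, zero_div]

end Summit.Ventures.CertifiedQuantumChemistry

end
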